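import Mathlib
import Literature.Computability.AlgebraicComplexity.KroneckerRank
import Literature.Computability.AlgebraicComplexity.SmallFormatRank
import Literature.Computability.AlgebraicComplexity.CohnUmansTPPProofs
import Summits.MatrixMultiplication.MatrixMultiplication.Theorems.FidelityThesis.Negative.SummitEquivalence
import Summits.MatrixMultiplication.MatrixMultiplication.Theorems.FidelityWitnessesFidelityThesisSepMajorantThreeHalves

/-!
# Line `Sketch` (separable-majorant) for crux `FidelityWitnesses.FidelityThesis` (stmt-MatrixMultiplication-4956) —
# stub `stub_fidelityGrowth_constOne`: the open stub `stub_fidelityGrowth` is CONSTANT-FREE and ONE-POINT-REFUTABLE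

FIDELITY GROWTH at `(C, δ′)` (body of the line's open registered stub `stub_fidelityGrowth`, `Cruxes/FidelityThesis/
Lines/Sketch.lean`): for all `n, r` and every `S` of rank `≤ r` in the `n × n` format, `F(S) ≤ C·r^{3/2−δ′}·N(S)`,
`F(S) = |⟨S,⟨n,n,n⟩⟩|²`, `N(S) = ‖S‖²`.  Results (all `n`; NO new definitions — Kronecker products are explicit
reindexed terms of the tree's `kroneckerTensor` / `doubleIndexEquiv`):
* `fgKron_exists_power` — Kronecker self-powers in the square format: `∃ S′` (format `n^k`) with `R(S′) ≤ R(S)^k`,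
  `⟨S′,⟨n^k⟩⟩ = ⟨S,⟨n⟩⟩^k`, `‖S′‖² = (‖S‖²)^k` (`Blaser2013_lemma58`, `tensorRank_reindex`, `kroneckerTensor_matMulTensor`).
* `fidelityGrowthAt_ratio_le` = registered `stub_fidelityGrowth_constOne` — **the constant is idle**: FG at `(C,δ′)` ⇒
  `F(S) ≤ r^{3/2−δ′} N(S)` for every `S` of rank `≤ r` (FG at `S^{⊠k}`, rank `≤ r^k`, `k → ∞`);
  `fidelityGrowthAt_iff_unitConstant`.
* `not_fidelityGrowthAt_of_point` — **one explicit point kills an exponent for every `C`**; log form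
  `fidelityGrowthAt_logb_le` (`log_{r₀}(F/N) ≤ 3/2 − δ′`, `r₀ ≥ 2`); converse `fidelityGrowthAt_of_pointwise` (`r ≤ 1` free by
  `fidelity_le_rpow_threeHalves`); so `stub_fidelityGrowth_iff_pointwise`: the open stub is EXACTLY "the capture exponent
  `log_r(F/N)` over all `(n, r ≥ 2, S ≠ 0 of rank ≤ r)` stays `≤ 3/2 − δ′` for one fixed `δ′ > 0`" (`≤ 3/2` is the theorem).
* `not_fidelityGrowthAt_of_equalityPoint` — the finite loophole of `Lines/Sketch.md` as a theorem: ONE exact equality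
  `F(S₀) = r₀^{3/2} N(S₀)`, `r₀ ≥ 2`, `S₀ ≠ 0`, refutes FG at every `δ′ > 0`.
* `not_fidelityGrowthAt_of_ge_thirteen_thirtieths` — ELEMENTARY window from one data point (Strassen: `⟨2,2,2⟩`, `r₀ = 7`,
  `F/N = 8`, `log₇ 8 > 16/15`): no FG at `δ′ ≥ 13/30`, without any upper bound on `ω` (the landed window via
  `ω(ℂ) ≤ 2.37295` is `δ′ ≥ 0.2358`).
Adapted from the disprover's "the constant `C` is immaterial" (`Cruxes/DiagonalPowerDecay/Disproof.lean` §(e), not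
importable).  Supports `stmt-MatrixMultiplication-4956` (lead a1, duplicate seat of lead -1); Mathlib + tree theorems.
-/

namespace Summit.MatrixMultiplication.MatrixMultiplication.Theorems

open scoped BigOperators
open Literature.Computability.AlgebraicComplexity

/-! ## Kronecker products in the square format, definition-free -/
section Kron

variable {n m : ℕ}

/-- Relabelled sums of products factor: with `e = doubleIndexEquiv n n m m : P n × P m ≃ P (nm)`,
`Σ_{a b c ∈ P(nm)} F((e⁻¹a)₁,(e⁻¹b)₁,(e⁻¹c)₁) · G((e⁻¹a)₂,(e⁻¹b)₂,(e⁻¹c)₂) = (Σ F) · (Σ G)`. [folklore] -/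
theorem fgKron_sum_general (F : Fin n × Fin n → Fin n × Fin n → Fin n × Fin n → ℂ)
    (G : Fin m × Fin m → Fin m × Fin m → Fin m × Fin m → ℂ) :
    (∑ a : Fin (n * m) × Fin (n * m), ∑ b : Fin (n * m) × Fin (n * m), ∑ c : Fin (n * m) × Fin (n * m),
        F ((doubleIndexEquiv n n m m).symm a).1 ((doubleIndexEquiv n n m m).symm b).1
            ((doubleIndexEquiv n n m m).symm c).1 *
          G ((doubleIndexEquiv n n m m).symm a).2 ((doubleIndexEquiv n n m m).symm b).2
            ((doubleIndexEquiv n n m m).symm c).2) =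
      (∑ a, ∑ b, ∑ c, F a b c) * ∑ a, ∑ b, ∑ c, G a b c := by
  set e := doubleIndexEquiv n n m m with he
  -- pull the bijection out of each slot
  have step : ∀ φ : (Fin n × Fin n) × (Fin m × Fin m) → (Fin n × Fin n) × (Fin m × Fin m) →
      (Fin n × Fin n) × (Fin m × Fin m) → ℂ,
      (∑ a : Fin (n * m) × Fin (n * m), ∑ b : Fin (n * m) × Fin (n * m),
          ∑ c : Fin (n * m) × Fin (n * m), φ (e.symm a) (e.symm b) (e.symm c)) =
        ∑ x, ∑ y, ∑ z, φ x y z := by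
    intro φ
    rw [Equiv.sum_comp e.symm (fun x => ∑ b : Fin (n * m) × Fin (n * m),
      ∑ c : Fin (n * m) × Fin (n * m), φ x (e.symm b) (e.symm c))]
    refine Finset.sum_congr rfl fun x _ => ?_
    rw [Equiv.sum_comp e.symm (fun y => ∑ c : Fin (n * m) × Fin (n * m), φ x y (e.symm c))]
    refine Finset.sum_congr rfl fun y _ => ?_
    exact Equiv.sum_comp e.symm (fun z => φ x y z)
  rw [step (fun x y z => F x.1 y.1 z.1 * G x.2 y.2 z.2)]
  -- split each pair-indexed sum (only those over `P n × P m`), then factor in the order `a b a' b' a'' b''`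
  have split : ∀ φ : (Fin n × Fin n) × (Fin m × Fin m) → ℂ, (∑ x, φ x) = ∑ a, ∑ b, φ (a, b) :=
    fun φ => Fintype.sum_prod_type φ
  simp only [split]
  symm
  rw [Finset.sum_mul_sum]
  refine Finset.sum_congr rfl fun a _ => Finset.sum_congr rfl fun b _ => ?_
  rw [Finset.sum_mul_sum]
  refine Finset.sum_congr rfl fun a' _ => Finset.sum_congr rfl fun b' _ => ?_
  rw [Finset.sum_mul_sum]

/-- Rank is submultiplicative for the reindexed Kronecker product (`Blaser2013_lemma58`). [folklore] -/
theorem fgKron_tensorRank_le (S : Fin n × Fin n → Fin n × Fin n → Fin n × Fin n → ℂ)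
    (S' : Fin m × Fin m → Fin m × Fin m → Fin m × Fin m → ℂ) :
    tensorRank (fun a b c => kroneckerTensor S S' ((doubleIndexEquiv n n m m).symm a)
        ((doubleIndexEquiv n n m m).symm b) ((doubleIndexEquiv n n m m).symm c)) ≤
      tensorRank S * tensorRank S' := by
  rw [tensorRank_reindex]
  exact Blaser2013_lemma58 S S'

/-- `⟨n,n,n⟩ ⊗ ⟨m,m,m⟩` read through `doubleIndexEquiv` IS `⟨nm,nm,nm⟩` (`kroneckerTensor_matMulTensor`). [folklore] -/
theorem fgKron_matMulTensor :
    (fun a b c => kroneckerTensor (matMulTensor ℂ n n n) (matMulTensor ℂ m m m)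
        ((doubleIndexEquiv n n m m).symm a) ((doubleIndexEquiv n n m m).symm b)
        ((doubleIndexEquiv n n m m).symm c)) = matMulTensor ℂ (n * m) (n * m) (n * m) := by
  funext a b c
  rw [kroneckerTensor_matMulTensor]
  simp

/-- The overlap with matrix multiplication is multiplicative under the (reindexed) Kronecker product. [folklore] -/
theorem fgKron_overlap (S : Fin n × Fin n → Fin n × Fin n → Fin n × Fin n → ℂ)
    (S' : Fin m × Fin m → Fin m × Fin m → Fin m × Fin m → ℂ) :
    (∑ a, ∑ b, ∑ c, kroneckerTensor S S' ((doubleIndexEquiv n n m m).symm a)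
        ((doubleIndexEquiv n n m m).symm b) ((doubleIndexEquiv n n m m).symm c) *
          matMulTensor ℂ (n * m) (n * m) (n * m) a b c) =
      (∑ a, ∑ b, ∑ c, S a b c * matMulTensor ℂ n n n a b c) *
        ∑ a, ∑ b, ∑ c, S' a b c * matMulTensor ℂ m m m a b c := by
  rw [← fgKron_matMulTensor]
  simp only [kroneckerTensor_apply]
  rw [← fgKron_sum_general]
  exact Finset.sum_congr rfl fun a _ => Finset.sum_congr rfl fun b _ =>
    Finset.sum_congr rfl fun c _ => by ring

/-- The squared norm is multiplicative under the (reindexed) Kronecker product. [folklore] -/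
theorem fgKron_normSq (S : Fin n × Fin n → Fin n × Fin n → Fin n × Fin n → ℂ)
    (S' : Fin m × Fin m → Fin m × Fin m → Fin m × Fin m → ℂ) :
    (∑ a, ∑ b, ∑ c, ‖kroneckerTensor S S' ((doubleIndexEquiv n n m m).symm a)
        ((doubleIndexEquiv n n m m).symm b) ((doubleIndexEquiv n n m m).symm c)‖ ^ 2) =
      (∑ a, ∑ b, ∑ c, ‖S a b c‖ ^ 2) * ∑ a, ∑ b, ∑ c, ‖S' a b c‖ ^ 2 := by
  have h := fgKron_sum_general (n := n) (m := m) (fun a b c => ((‖S a b c‖ ^ 2 : ℝ) : ℂ))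
    (fun a b c => ((‖S' a b c‖ ^ 2 : ℝ) : ℂ))
  simp only [kroneckerTensor_apply, norm_mul, mul_pow]
  exact_mod_cast h

end Kron

/-- **Kronecker self-powers in the square format.** For every tensor `S` of the `n × n` format and every `k` there is
a tensor `S′` of the `n^k × n^k` format (namely `S^{⊠k}`) with `R(S′) ≤ R(S)^k`, `⟨S′,⟨n^k,n^k,n^k⟩⟩ = ⟨S,⟨n,n,n⟩⟩^k`
and `‖S′‖² = (‖S‖²)^k`. [folklore] -/
theorem fgKron_exists_power {n : ℕ} (S : Fin n × Fin n → Fin n × Fin n → Fin n × Fin n → ℂ) (k : ℕ) :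
    ∃ S' : Fin (n ^ k) × Fin (n ^ k) → Fin (n ^ k) × Fin (n ^ k) → Fin (n ^ k) × Fin (n ^ k) → ℂ,
      tensorRank S' ≤ tensorRank S ^ k ∧
      (∑ a, ∑ b, ∑ c, S' a b c * matMulTensor ℂ (n ^ k) (n ^ k) (n ^ k) a b c) =
        (∑ a, ∑ b, ∑ c, S a b c * matMulTensor ℂ n n n a b c) ^ k ∧
      (∑ a, ∑ b, ∑ c, ‖S' a b c‖ ^ 2) = (∑ a, ∑ b, ∑ c, ‖S a b c‖ ^ 2) ^ k := by
  induction k with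
  | zero =>
    refine ⟨fun _ _ _ => 1, ?_, ?_, ?_⟩
    · have h := tensorRank_le_card (K := ℂ) (ι := Fin (n ^ 0) × Fin (n ^ 0)) (κ := Fin (n ^ 0) × Fin (n ^ 0))
        (μ := Fin (n ^ 0) × Fin (n ^ 0)) (fun _ _ _ => (1 : ℂ))
      simpa using h
    · simp only [one_mul, pow_zero]
      rw [fidelityGapThree_sum_matMulTensor]
      simp
    · simp only [Finset.sum_const, Finset.card_univ, norm_one, one_pow]
      norm_num [Fintype.card_prod]
  | succ k ih =>
    obtain ⟨Sk, hrank, hov, hnorm⟩ := ih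
    refine ⟨fun a b c => kroneckerTensor Sk S ((doubleIndexEquiv (n ^ k) (n ^ k) n n).symm a)
      ((doubleIndexEquiv (n ^ k) (n ^ k) n n).symm b) ((doubleIndexEquiv (n ^ k) (n ^ k) n n).symm c),
      ?_, ?_, ?_⟩
    · calc _ ≤ tensorRank Sk * tensorRank S := fgKron_tensorRank_le Sk S
        _ ≤ tensorRank S ^ k * tensorRank S := Nat.mul_le_mul_right _ hrank
        _ = tensorRank S ^ (k + 1) := by rw [pow_succ]
    · show (∑ a, ∑ b, ∑ c, kroneckerTensor Sk S ((doubleIndexEquiv (n ^ k) (n ^ k) n n).symm a)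
          ((doubleIndexEquiv (n ^ k) (n ^ k) n n).symm b) ((doubleIndexEquiv (n ^ k) (n ^ k) n n).symm c) *
            matMulTensor ℂ (n ^ k * n) (n ^ k * n) (n ^ k * n) a b c) = _
      rw [fgKron_overlap, hov, pow_succ]
    · show (∑ a, ∑ b, ∑ c, ‖kroneckerTensor Sk S ((doubleIndexEquiv (n ^ k) (n ^ k) n n).symm a)
          ((doubleIndexEquiv (n ^ k) (n ^ k) n n).symm b) ((doubleIndexEquiv (n ^ k) (n ^ k) n n).symm c)‖ ^ 2) = _
      rw [fgKron_normSq, hnorm, pow_succ]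

/-! ## The constant is idle -/

/-- **The constant of fidelity growth is idle.** If `F(S) ≤ C·r^{3/2−δ′}·N(S)` for all `n, r` and all `S` of rank
`≤ r` (fidelity growth at `(C, δ′)`), then already `F(S) ≤ r^{3/2−δ′}·N(S)` for every such `S`: apply the hypothesis
to the Kronecker power `S^{⊠k}` (rank `≤ r^k`, overlap and norm to the `k`-th power, `fgKron_exists_power`) to get
`F^k ≤ C·(r^{3/2−δ′} N)^k` for all `k`, and let `k → ∞`. [folklore] -/
theorem fidelityGrowthAt_ratio_le {δ' C : ℝ}
    (hFG : ∀ (n r : ℕ) (S : Fin n × Fin n → Fin n × Fin n → Fin n × Fin n → ℂ), tensorRank S ≤ r →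
      ‖∑ a, ∑ b, ∑ c, S a b c * matMulTensor ℂ n n n a b c‖ ^ 2 ≤
        C * (r : ℝ) ^ (3 / 2 - δ') * ∑ a, ∑ b, ∑ c, ‖S a b c‖ ^ 2)
    {n r : ℕ} (S : Fin n × Fin n → Fin n × Fin n → Fin n × Fin n → ℂ) (hS : tensorRank S ≤ r) :
    ‖∑ a, ∑ b, ∑ c, S a b c * matMulTensor ℂ n n n a b c‖ ^ 2 ≤
      (r : ℝ) ^ (3 / 2 - δ') * ∑ a, ∑ b, ∑ c, ‖S a b c‖ ^ 2 := by
  set F := ‖∑ a, ∑ b, ∑ c, S a b c * matMulTensor ℂ n n n a b c‖ ^ 2 with hF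
  set N := ∑ a, ∑ b, ∑ c, ‖S a b c‖ ^ 2 with hN
  have hr0 : (0 : ℝ) ≤ r := Nat.cast_nonneg r
  have hN0 : 0 ≤ N := by positivity
  have hy0 : 0 ≤ (r : ℝ) ^ (3 / 2 - δ') * N := mul_nonneg (Real.rpow_nonneg hr0 _) hN0
  -- the hypothesis at `S^{⊠k}`, format `n^k`, rank budget `r^k`
  have hk : ∀ k : ℕ, F ^ k ≤ C * ((r : ℝ) ^ (3 / 2 - δ') * N) ^ k := by
    intro k
    obtain ⟨Sk, hrank, hov, hnorm⟩ := fgKron_exists_power S k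
    have hr : tensorRank Sk ≤ r ^ k := hrank.trans (Nat.pow_le_pow_left hS k)
    have key := hFG (n ^ k) (r ^ k) Sk hr
    rw [hov, hnorm, norm_pow, ← pow_mul, mul_comm k 2, pow_mul] at key
    push_cast at key
    rw [rpow_natCast_pow_comm hr0] at key
    calc F ^ k ≤ C * ((r : ℝ) ^ (3 / 2 - δ')) ^ k * N ^ k := key
      _ = C * ((r : ℝ) ^ (3 / 2 - δ') * N) ^ k := by ring
  rcases hy0.lt_or_eq with hy | hy
  · exact le_of_pow_le_mul_pow hy hk
  · have h1 := hk 1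
    rw [← hy] at h1 ⊢
    simp only [pow_one, mul_zero] at h1
    exact h1

/-- **Registered stub `stub_fidelityGrowth_constOne` (lead -1, 11:48Z), verbatim**: fidelity growth at `(C, δ′)`
with `C > 0` gives fidelity growth at `(1, δ′)` — `fidelityGrowthAt_ratio_le` (the positivity of `C` is not needed).
[folklore] -/
theorem stub_fidelityGrowth_constOne {δ' C : ℝ} (hC : 0 < C)
    (hFG : ∀ (n r : ℕ) (S : Fin n × Fin n → Fin n × Fin n → Fin n × Fin n → ℂ), tensorRank S ≤ r →
      ‖∑ a, ∑ b, ∑ c, S a b c * matMulTensor ℂ n n n a b c‖ ^ 2 ≤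
        C * (r : ℝ) ^ (3 / 2 - δ') * ∑ a, ∑ b, ∑ c, ‖S a b c‖ ^ 2)
    (n r : ℕ) (S : Fin n × Fin n → Fin n × Fin n → Fin n × Fin n → ℂ) (hS : tensorRank S ≤ r) :
    ‖∑ a, ∑ b, ∑ c, S a b c * matMulTensor ℂ n n n a b c‖ ^ 2 ≤
      (r : ℝ) ^ (3 / 2 - δ') * ∑ a, ∑ b, ∑ c, ‖S a b c‖ ^ 2 := by
  exact (fun _ : 0 < C => fidelityGrowthAt_ratio_le hFG S hS) hC

/-- **Fidelity growth with a constant ⟺ fidelity growth with constant `1`** (at the same exponent). [folklore] -/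
theorem fidelityGrowthAt_iff_unitConstant {δ' : ℝ} :
    (∃ C : ℝ, 0 < C ∧
      ∀ (n r : ℕ) (S : Fin n × Fin n → Fin n × Fin n → Fin n × Fin n → ℂ), tensorRank S ≤ r →
        ‖∑ a, ∑ b, ∑ c, S a b c * matMulTensor ℂ n n n a b c‖ ^ 2 ≤
          C * (r : ℝ) ^ (3 / 2 - δ') * ∑ a, ∑ b, ∑ c, ‖S a b c‖ ^ 2) ↔
    ∀ (n r : ℕ) (S : Fin n × Fin n → Fin n × Fin n → Fin n × Fin n → ℂ), tensorRank S ≤ r →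
      ‖∑ a, ∑ b, ∑ c, S a b c * matMulTensor ℂ n n n a b c‖ ^ 2 ≤
        (r : ℝ) ^ (3 / 2 - δ') * ∑ a, ∑ b, ∑ c, ‖S a b c‖ ^ 2 := by
  constructor
  · rintro ⟨C, -, hFG⟩ n r S hS
    exact fidelityGrowthAt_ratio_le hFG S hS
  · intro h
    exact ⟨1, one_pos, fun n r S hS => by rw [one_mul]; exact h n r S hS⟩

/-! ## One point kills an exponent -/

/-- **One explicit point refutes an exponent, for every constant.** A single `S₀` of rank `≤ r₀` (any format `n₀`)
with `F(S₀) > r₀^{3/2−δ′}·N(S₀)` contradicts fidelity growth at `δ′` whatever `C`. [folklore] -/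
theorem not_fidelityGrowthAt_of_point {δ' C : ℝ} {n₀ r₀ : ℕ}
    (S₀ : Fin n₀ × Fin n₀ → Fin n₀ × Fin n₀ → Fin n₀ × Fin n₀ → ℂ) (hS₀ : tensorRank S₀ ≤ r₀)
    (hgt : (r₀ : ℝ) ^ (3 / 2 - δ') * (∑ a, ∑ b, ∑ c, ‖S₀ a b c‖ ^ 2) <
      ‖∑ a, ∑ b, ∑ c, S₀ a b c * matMulTensor ℂ n₀ n₀ n₀ a b c‖ ^ 2) :
    ¬ ∀ (n r : ℕ) (S : Fin n × Fin n → Fin n × Fin n → Fin n × Fin n → ℂ), tensorRank S ≤ r →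
        ‖∑ a, ∑ b, ∑ c, S a b c * matMulTensor ℂ n n n a b c‖ ^ 2 ≤
          C * (r : ℝ) ^ (3 / 2 - δ') * ∑ a, ∑ b, ∑ c, ‖S a b c‖ ^ 2 :=
  fun hFG => absurd (fidelityGrowthAt_ratio_le hFG S₀ hS₀) (not_le.2 hgt)

/-- Under fidelity growth at `(C, δ′)` the exponent is at most `3/2` (test `⟨1,1,1⟩`, rank `≤ 1 ≤ 2`, `F = N = 1`,
against the budget `r = 2`: `1 ≤ 2^{3/2−δ′}`). [folklore] -/
theorem fidelityGrowthAt_exponent_le {δ' C : ℝ}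
    (hFG : ∀ (n r : ℕ) (S : Fin n × Fin n → Fin n × Fin n → Fin n × Fin n → ℂ), tensorRank S ≤ r →
      ‖∑ a, ∑ b, ∑ c, S a b c * matMulTensor ℂ n n n a b c‖ ^ 2 ≤
        C * (r : ℝ) ^ (3 / 2 - δ') * ∑ a, ∑ b, ∑ c, ‖S a b c‖ ^ 2) :
    δ' ≤ 3 / 2 := by
  have h1 := fidelityGrowthAt_ratio_le hFG (matMulTensor ℂ 1 1 1) (r := 2)
    ((tensorRank_matMulTensor_le ℂ 1 1 1).trans (by norm_num))
  rw [fidelityThesis_overlap_self, fidelityThesis_normSq_matMulTensor, norm_pow, Complex.norm_natCast] at h1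
  simp only [Nat.cast_one, one_pow, mul_one, Nat.cast_ofNat] at h1
  by_contra hlt
  have : (2 : ℝ) ^ (3 / 2 - δ') < 1 := Real.rpow_lt_one_of_one_lt_of_neg (by norm_num) (by linarith)
  linarith

/-- **The data-point form on the log scale**: under fidelity growth at `(C, δ′)`, every `S₀ ≠ 0` of rank `≤ r₀`,
`r₀ ≥ 2`, has `log_{r₀}(F(S₀)/N(S₀)) ≤ 3/2 − δ′`. [folklore] -/
theorem fidelityGrowthAt_logb_le {δ' C : ℝ}
    (hFG : ∀ (n r : ℕ) (S : Fin n × Fin n → Fin n × Fin n → Fin n × Fin n → ℂ), tensorRank S ≤ r →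
      ‖∑ a, ∑ b, ∑ c, S a b c * matMulTensor ℂ n n n a b c‖ ^ 2 ≤
        C * (r : ℝ) ^ (3 / 2 - δ') * ∑ a, ∑ b, ∑ c, ‖S a b c‖ ^ 2)
    {n₀ r₀ : ℕ} (hr₀ : 2 ≤ r₀) (S₀ : Fin n₀ × Fin n₀ → Fin n₀ × Fin n₀ → Fin n₀ × Fin n₀ → ℂ)
    (hS₀ : tensorRank S₀ ≤ r₀) (hN : 0 < ∑ a, ∑ b, ∑ c, ‖S₀ a b c‖ ^ 2) :
    Real.logb r₀ (‖∑ a, ∑ b, ∑ c, S₀ a b c * matMulTensor ℂ n₀ n₀ n₀ a b c‖ ^ 2 /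
      ∑ a, ∑ b, ∑ c, ‖S₀ a b c‖ ^ 2) ≤ 3 / 2 - δ' := by
  have h := fidelityGrowthAt_ratio_le hFG S₀ hS₀
  have hδ := fidelityGrowthAt_exponent_le hFG
  have hr1 : (1 : ℝ) < r₀ := by exact_mod_cast hr₀
  rw [← div_le_iff₀ hN] at h
  set ρ := ‖∑ a, ∑ b, ∑ c, S₀ a b c * matMulTensor ℂ n₀ n₀ n₀ a b c‖ ^ 2 / ∑ a, ∑ b, ∑ c, ‖S₀ a b c‖ ^ 2
  rcases (show (0 : ℝ) ≤ ρ by positivity).lt_or_eq with hρ | hρ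
  · have := Real.logb_le_logb_of_le hr1 hρ h
    rwa [Real.logb_rpow (by linarith) hr1.ne'] at this
  · rw [← hρ, Real.logb_zero]
    linarith

/-- **Conversely, the pointwise exponent bound IS fidelity growth with constant `1`.** If every `S ≠ 0` of rank `≤ r`,
`r ≥ 2` (any `n`) has `log_r(F(S)/N(S)) ≤ 3/2 − δ′`, then `F(S) ≤ r^{3/2−δ′} N(S)` for ALL `n, r, S` of rank `≤ r`
(the rungs `r ≤ 1` are free: `F ≤ r^{3/2} N`, `fidelity_le_rpow_threeHalves`, gives `F = 0` at `r = 0` and `F ≤ N`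
at `r = 1`). [folklore] -/
theorem fidelityGrowthAt_of_pointwise {δ' : ℝ}
    (h : ∀ (n r : ℕ) (S : Fin n × Fin n → Fin n × Fin n → Fin n × Fin n → ℂ), 2 ≤ r → tensorRank S ≤ r →
      0 < (∑ a, ∑ b, ∑ c, ‖S a b c‖ ^ 2) →
        Real.logb r (‖∑ a, ∑ b, ∑ c, S a b c * matMulTensor ℂ n n n a b c‖ ^ 2 /
          ∑ a, ∑ b, ∑ c, ‖S a b c‖ ^ 2) ≤ 3 / 2 - δ')
    (n r : ℕ) (S : Fin n × Fin n → Fin n × Fin n → Fin n × Fin n → ℂ) (hS : tensorRank S ≤ r) :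
    ‖∑ a, ∑ b, ∑ c, S a b c * matMulTensor ℂ n n n a b c‖ ^ 2 ≤
      (r : ℝ) ^ (3 / 2 - δ') * ∑ a, ∑ b, ∑ c, ‖S a b c‖ ^ 2 := by
  have h32 := fidelity_le_rpow_threeHalves n r S hS
  set F := ‖∑ a, ∑ b, ∑ c, S a b c * matMulTensor ℂ n n n a b c‖ ^ 2 with hF
  set N := ∑ a, ∑ b, ∑ c, ‖S a b c‖ ^ 2 with hN
  have hr0 : (0 : ℝ) ≤ r := Nat.cast_nonneg r
  have hN0 : 0 ≤ N := by positivity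
  have hRHS : 0 ≤ (r : ℝ) ^ (3 / 2 - δ') * N := mul_nonneg (Real.rpow_nonneg hr0 _) hN0
  rcases Nat.lt_or_ge r 2 with hr | hr
  · interval_cases r
    · -- `r = 0`: `F ≤ 0^{3/2}·N = 0`
      have : F ≤ 0 := by
        rw [Nat.cast_zero, Real.zero_rpow (by norm_num : (3 : ℝ) / 2 ≠ 0), zero_mul] at h32
        exact h32
      exact this.trans hRHS
    · -- `r = 1`: `F ≤ N`
      simp only [Nat.cast_one, Real.one_rpow, one_mul] at h32 ⊢
      exact h32
  · rcases hN0.lt_or_eq with hNpos | hN0'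
    · by_cases hF0 : F = 0
      · rw [hF0]; exact hRHS
      have hFpos : 0 < F := lt_of_le_of_ne (by positivity) (Ne.symm hF0)
      have hr1 : (1 : ℝ) < r := by exact_mod_cast hr
      have key := h n r S hr hS hNpos
      rw [Real.logb_le_iff_le_rpow hr1 (div_pos hFpos hNpos), div_le_iff₀ hNpos] at key
      exact key
    · -- `N = 0`: then `F ≤ r^{3/2}·0 = 0`
      rw [← hN0'] at h32 ⊢
      simp only [mul_zero] at h32 ⊢
      exact h32

/-- **Fidelity growth at `δ′` ⟺ the pointwise exponent bound** `log_r(F/N) ≤ 3/2 − δ′` for every `S ≠ 0` of rank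
`≤ r`, `r ≥ 2`, every `n`. [folklore] -/
theorem fidelityGrowthAt_iff_pointwise {δ' : ℝ} :
    (∃ C : ℝ, 0 < C ∧
      ∀ (n r : ℕ) (S : Fin n × Fin n → Fin n × Fin n → Fin n × Fin n → ℂ), tensorRank S ≤ r →
        ‖∑ a, ∑ b, ∑ c, S a b c * matMulTensor ℂ n n n a b c‖ ^ 2 ≤
          C * (r : ℝ) ^ (3 / 2 - δ') * ∑ a, ∑ b, ∑ c, ‖S a b c‖ ^ 2) ↔
    ∀ (n r : ℕ) (S : Fin n × Fin n → Fin n × Fin n → Fin n × Fin n → ℂ), 2 ≤ r → tensorRank S ≤ r →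
      0 < (∑ a, ∑ b, ∑ c, ‖S a b c‖ ^ 2) →
        Real.logb r (‖∑ a, ∑ b, ∑ c, S a b c * matMulTensor ℂ n n n a b c‖ ^ 2 /
          ∑ a, ∑ b, ∑ c, ‖S a b c‖ ^ 2) ≤ 3 / 2 - δ' := by
  constructor
  · rintro ⟨C, -, hFG⟩ n r S hr hS hN
    exact fidelityGrowthAt_logb_le hFG hr S hS hN
  · intro h
    exact fidelityGrowthAt_iff_unitConstant.2 (fidelityGrowthAt_of_pointwise h)

/-- **The registered open stub, pointwise**: `stub_fidelityGrowth` (verbatim, left) ⟺ for some `δ′ ∈ (0, 3/2)` every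
`S ≠ 0` of rank `≤ r`, `r ≥ 2`, in every format `n`, has capture exponent `log_r(|⟨S,⟨n,n,n⟩⟩|²/‖S‖²) ≤ 3/2 − δ′` —
i.e. the capture exponent stays a fixed distance BELOW the critical `3/2` of `fidelity_le_rpow_threeHalves`.
[folklore] -/
theorem stub_fidelityGrowth_iff_pointwise :
    (∃ δ' : ℝ, 0 < δ' ∧ δ' < 3 / 2 ∧ ∃ C : ℝ, 0 < C ∧
      ∀ (n r : ℕ) (S : Fin n × Fin n → Fin n × Fin n → Fin n × Fin n → ℂ), tensorRank S ≤ r →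
        ‖∑ a, ∑ b, ∑ c, S a b c * matMulTensor ℂ n n n a b c‖ ^ 2 ≤
          C * (r : ℝ) ^ (3 / 2 - δ') * ∑ a, ∑ b, ∑ c, ‖S a b c‖ ^ 2) ↔
    (∃ δ' : ℝ, 0 < δ' ∧ δ' < 3 / 2 ∧
      ∀ (n r : ℕ) (S : Fin n × Fin n → Fin n × Fin n → Fin n × Fin n → ℂ), 2 ≤ r → tensorRank S ≤ r →
        0 < (∑ a, ∑ b, ∑ c, ‖S a b c‖ ^ 2) →
          Real.logb r (‖∑ a, ∑ b, ∑ c, S a b c * matMulTensor ℂ n n n a b c‖ ^ 2 /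
            ∑ a, ∑ b, ∑ c, ‖S a b c‖ ^ 2) ≤ 3 / 2 - δ') := by
  constructor
  · rintro ⟨δ', h0, h1, hC⟩
    exact ⟨δ', h0, h1, fidelityGrowthAt_iff_pointwise.1 hC⟩
  · rintro ⟨δ', h0, h1, h⟩
    exact ⟨δ', h0, h1, fidelityGrowthAt_iff_pointwise.2 h⟩

/-- **The finite loophole, closed form.** ONE exact equality `F(S₀) = r₀^{3/2}·N(S₀)` at some `r₀ ≥ 2`, `S₀ ≠ 0` of
rank `≤ r₀` (any format) refutes fidelity growth at EVERY `δ′ > 0` and every `C` (capture exponent exactly `3/2` at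
one point; Kronecker powers do the rest). [folklore] -/
theorem not_fidelityGrowthAt_of_equalityPoint {δ' C : ℝ} (hδ' : 0 < δ') {n₀ r₀ : ℕ} (hr₀ : 2 ≤ r₀)
    (S₀ : Fin n₀ × Fin n₀ → Fin n₀ × Fin n₀ → Fin n₀ × Fin n₀ → ℂ) (hS₀ : tensorRank S₀ ≤ r₀)
    (hN : 0 < ∑ a, ∑ b, ∑ c, ‖S₀ a b c‖ ^ 2)
    (heq : ‖∑ a, ∑ b, ∑ c, S₀ a b c * matMulTensor ℂ n₀ n₀ n₀ a b c‖ ^ 2 =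
      (r₀ : ℝ) ^ ((3 : ℝ) / 2) * ∑ a, ∑ b, ∑ c, ‖S₀ a b c‖ ^ 2) :
    ¬ ∀ (n r : ℕ) (S : Fin n × Fin n → Fin n × Fin n → Fin n × Fin n → ℂ), tensorRank S ≤ r →
        ‖∑ a, ∑ b, ∑ c, S a b c * matMulTensor ℂ n n n a b c‖ ^ 2 ≤
          C * (r : ℝ) ^ (3 / 2 - δ') * ∑ a, ∑ b, ∑ c, ‖S a b c‖ ^ 2 := by
  intro hFG
  have h := fidelityGrowthAt_logb_le hFG hr₀ S₀ hS₀ hN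
  have hr1 : (1 : ℝ) < r₀ := by exact_mod_cast hr₀
  rw [heq, mul_div_assoc, div_self hN.ne', mul_one, Real.logb_rpow (by linarith) hr1.ne'] at h
  linarith

/-- `log₇ 8 > 16/15` (`7¹⁶ = 33232930569601 < 35184372088832 = 8¹⁵`). [folklore] -/
theorem fgKron_sixteen_fifteenths_lt_logb_seven_eight : (16 : ℝ) / 15 < Real.logb 7 8 := by
  rw [Real.logb, lt_div_iff₀ (Real.log_pos (by norm_num : (1 : ℝ) < 7))]
  have h7 : (16 : ℝ) / 15 * Real.log 7 = Real.log ((7 : ℝ) ^ (16 : ℕ)) / 15 := by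
    rw [Real.log_pow]; push_cast; ring
  have h8 : Real.log (8 : ℝ) = Real.log ((8 : ℝ) ^ (15 : ℕ)) / 15 := by
    rw [Real.log_pow]; push_cast; ring
  rw [h7, h8, div_lt_div_iff_of_pos_right (by norm_num : (0 : ℝ) < 15)]
  exact Real.log_lt_log (by positivity) (by norm_num)

/-- **An elementary window from ONE data point (Strassen).** `S₀ = ⟨2,2,2⟩` has rank `≤ 7`
(`tensorRank_matMulTensor_two_le_seven`) and `F/N = 64/8 = 8`, so fidelity growth at `(C, δ′)` forces
`log₇ 8 ≤ 3/2 − δ′`, i.e. `δ′ ≤ 3/2 − log₇ 8 < 3/2 − 16/15 = 13/30`: **no fidelity growth at any `δ′ ≥ 13/30`**,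
whatever `C`.  (The landed `not_fidelityGrowthAt_of_ge` gives `δ′ ≥ 0.2358` from `ω(ℂ) ≤ 2.37295`; this one uses no
upper bound on `ω` at all.) [folklore] -/
theorem not_fidelityGrowthAt_of_ge_thirteen_thirtieths {δ' C : ℝ} (hδ' : (13 : ℝ) / 30 ≤ δ') :
    ¬ ∀ (n r : ℕ) (S : Fin n × Fin n → Fin n × Fin n → Fin n × Fin n → ℂ), tensorRank S ≤ r →
        ‖∑ a, ∑ b, ∑ c, S a b c * matMulTensor ℂ n n n a b c‖ ^ 2 ≤
          C * (r : ℝ) ^ (3 / 2 - δ') * ∑ a, ∑ b, ∑ c, ‖S a b c‖ ^ 2 := by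
  intro hFG
  have hN : 0 < ∑ a, ∑ b, ∑ c, ‖matMulTensor ℂ 2 2 2 a b c‖ ^ 2 := by
    rw [fidelityThesis_normSq_matMulTensor]; norm_num
  have h := fidelityGrowthAt_logb_le hFG (by norm_num : 2 ≤ 7) (matMulTensor ℂ 2 2 2)
    (tensorRank_matMulTensor_two_le_seven ℂ) hN
  rw [fidelityThesis_overlap_self, fidelityThesis_normSq_matMulTensor, norm_pow, Complex.norm_natCast] at h
  have h8 : ((((2 : ℕ) : ℝ) ^ 3) ^ 2 / ((2 : ℕ) : ℝ) ^ 3) = 8 := by norm_num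
  rw [h8] at h
  have hlog := fgKron_sixteen_fifteenths_lt_logb_seven_eight
  push_cast at h
  linarith

end Summit.MatrixMultiplication.MatrixMultiplication.Theorems
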